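import Mathlib.Geometry.Manifold.ContMDiff.Basic
import Literature.Geometry.Lorentzian.Hypersurface
import Literature.Topology.FourManifolds.SmoothEmbeddingComp
import HarnessLib

/-!
# Restriction of immersed hypersurfaces to open subsets (locality of the mean curvature)

Companion to `Literature.Geometry.Lorentzian.Hypersurface` (family `gr`; used by the reduction
of the general-horizon Riemannian Penrose inequality, `OutermostHorizonSmooth.lean`, to pass
from a compact embedded minimal surface to its connected components). For an immersion
`f : N → (M, g)` with a field `ν` along it and an **open** subset `W ⊆ N` (an open submanifold,
Mathlib's `TopologicalSpace.Opens` charted-space structure, whose charts are the restricted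
charts of `N`), the restricted data `f|_W = f ∘ ι`, `ν|_W = ν ∘ ι` (`ι : W → N` the inclusion)
have, at every `y ∈ W`, the same differential, induced form, unit-normal property, covariant
normal derivative `D_v ν`, second fundamental form and **mean curvature** as `(f, ν)` at `y`;
hence a spacelike immersion / unit normal / smooth normal / smooth embedding / minimal
(maximal) immersion restricts to one (`IsSpacelikeImmersion.comp_subtypeVal`,
`IsUnitNormal.comp_subtypeVal`, `contMDiff_normal_comp_subtypeVal`,
`isSmoothEmbedding_comp_subtypeVal`, `IsMaximalSlice.comp_subtypeVal`). Everything here is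
PROVED; there are no new definitions and no named facts.

The one point requiring care is that the tree's second fundamental form
(`PseudoRiemannianMetric.secondFundamentalForm`) is computed through `normalDerivAlong`, the
covariant derivative (`covariantDerivAlong` of `Geodesic.lean`, a local-frame formula involving
one-variable derivatives of coefficient functions) of `t ↦ ν (c t)` along the image of the
*chart-straight curve* `c = curveThrough I' y v` of the source manifold. The chart of `W` at `y`
is the restriction of the chart of `N` at `ι y` (`TopologicalSpace.Opens.chartAt_eq`), so the
chart-straight curves of `W` and `N` agree near `t = 0`
(`subtypeVal_comp_curveThrough_eventuallyEq`; globally they may differ, the inverse charts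
taking junk values off their targets), and `covariantDerivAlong` only depends on the germ of the
lifted curve (`covariantDerivAlong_congr_of_eventuallyEq`, the general form of the tree's
`covariantDerivAlong_velocity_congr`). The metric trace entering the mean curvature is compared
across the two base manifolds through the scalar product on the common model fibre
(`PseudoRiemannianMetric.sharp_congr_of_val_eq`, `trace_congr_of_val_eq`: cross-base equations,
both sides living in the model space, in the style of the cross-fibre equations of
`Geodesic.lean`).

## Mathlib

Mathlib (at the pin) provides the open-submanifold structure (`TopologicalSpace.Opens`
instances, `contMDiff_subtype_val`, `TopologicalSpace.Opens.chartAt_subtype_val_symm_eventuallyEq`,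
`ContMDiffWithinAt.subtypeVal_comp_iff`, `Manifold.IsSmoothEmbedding.of_opens`) but records the
composition of immersions / smooth embeddings as TODO (`Mathlib/Geometry/Manifold/Immersion.lean`,
`SmoothEmbedding.lean`); the restriction of an embedding to an open subset is obtained from the
tree's `Manifold.IsSmoothEmbedding.comp_openPartialHomeomorph`
(`Literature.Topology.FourManifolds.SmoothEmbeddingComp`). The identity
`mfderiv (Subtype.val) = id` is re-derived here (`hasMFDerivAt_subtypeVal`; refactor: it is the
tree's `Literature.Topology.FourManifolds.hasMFDerivAt_subtype_val` of
`OrientedConnectedSumSphereSelf.lean`, restated to keep connected-sum theory out of the import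
closure of the Lorentzian files).

## References

* B. O'Neill, *Semi-Riemannian Geometry*, Academic Press 1983, Ch. 3, Prop. 3.18 (induced
  covariant derivative along a curve, local formula), pp. 60–61 (metric contraction); Ch. 4,
  pp. 97–99 and Lemma 4.4 ff. (induced connection and shape tensor of a semi-Riemannian
  submanifold — local objects).
* J. M. Lee, *Introduction to Smooth Manifolds*, 2nd ed., Springer 2013, Example 1.26 and
  Prop. 3.9 (open submanifolds, `T_p W = T_p N`), Ch. 5 (restricting embeddings).
* R. M. Wald, *General Relativity*, Chicago 1984, (10.2.13) (extrinsic curvature and its trace).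
-/

noncomputable section

open Bundle Set Filter Function
open scoped Manifold ContDiff Topology

namespace Literature.Geometry.Lorentzian

variable {E : Type*} [NormedAddCommGroup E] [NormedSpace ℝ E] {H : Type*} [TopologicalSpace H]
  {I : ModelWithCorners ℝ E H} {M : Type*} [TopologicalSpace M] [ChartedSpace H M]
  {E' : Type*} [NormedAddCommGroup E'] [NormedSpace ℝ E'] {H' : Type*} [TopologicalSpace H']
  {I' : ModelWithCorners ℝ E' H'} {N : Type*} [TopologicalSpace N] [ChartedSpace H' N]

/-! ### The inclusion of an open subset: differential and chart-straight curves -/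

section SubtypeVal

variable {W : TopologicalSpace.Opens N}

/-- **The inclusion of an open submanifold has identity differential** (in the preferred charts —
the chart of `W` at `y` is the restricted chart of `N` at `↑y` — the inclusion reads as the
identity near the base point; Lee, *Introduction to Smooth Manifolds* (2013), Prop. 3.9:
`T_p W = T_p N`). refactor: this is the tree's
`Literature.Topology.FourManifolds.hasMFDerivAt_subtype_val` (`OrientedConnectedSumSphereSelf.lean`),
restated to keep the import closure of this file free of connected-sum theory. [folklore] -/
theorem hasMFDerivAt_subtypeVal (y : W) :
    HasMFDerivAt I' I' (Subtype.val : W → N) y (ContinuousLinearMap.id ℝ E') := by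
  refine ⟨continuous_subtype_val.continuousAt, ?_⟩
  have h1 := TopologicalSpace.Opens.chartAt_subtype_val_symm_eventuallyEq (H := H') W (x := y)
  have h2 : ContinuousAt I'.symm ((extChartAt I' y) y) := I'.continuous_symm.continuousAt
  have h3 : I'.symm ((extChartAt I' y) y) = chartAt H' (y : N) y := by
    simp only [extChartAt_coe, Function.comp_apply, ModelWithCorners.left_inv]
    rfl
  rw [ContinuousAt, h3] at h2
  have hA : ∀ᶠ z in 𝓝 ((extChartAt I' y) y),
      (((extChartAt I' y).symm z : W) : N) = (extChartAt I' (y : N)).symm z := by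
    filter_upwards [h2.eventually h1] with z hz
    simp only [Function.comp_apply, TopologicalSpace.Opens.chartAt_eq] at hz
    simp only [extChartAt_coe_symm, Function.comp_apply, TopologicalSpace.Opens.chartAt_eq]
    exact hz.symm
  have hB : ∀ᶠ z in 𝓝[range I'] ((extChartAt I' y) y), z ∈ (extChartAt I' (y : N)).target :=
    extChartAt_target_mem_nhdsWithin (y : N)
  have heq : writtenInExtChartAt I' I' y (Subtype.val : W → N) =ᶠ[𝓝[range I'] ((extChartAt I' y) y)]
      id := by
    filter_upwards [hA.filter_mono nhdsWithin_le_nhds, hB] with z hz hz'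
    simp only [writtenInExtChartAt, Function.comp_apply, id_eq]
    rw [hz]
    exact (extChartAt I' (y : N)).right_inv hz'
  refine (hasFDerivWithinAt_id _ _).congr_of_eventuallyEq heq ?_
  simp only [writtenInExtChartAt, Function.comp_apply, extChartAt_to_inv, id_eq]
  rfl

/-- The differential of the inclusion of an open submanifold is the identity. [folklore] -/
theorem mfderiv_subtypeVal (y : W) :
    mfderiv I' I' (Subtype.val : W → N) y = ContinuousLinearMap.id ℝ E' :=
  (hasMFDerivAt_subtypeVal y).mfderiv

/-- **Chain rule for the restriction to an open subset**: the differential of `f|_W = f ∘ ι` at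
`y ∈ W` is the differential of `f` at `y` (`dι = id`). [folklore] -/
theorem mfderiv_comp_subtypeVal {f : N → M} {y : W} (hf : MDifferentiableAt I' I f y.1) :
    mfderiv I' I (f ∘ Subtype.val : W → M) y = mfderiv I' I f y.1 := by
  rw [mfderiv_comp y hf (hasMFDerivAt_subtypeVal y).mdifferentiableAt, mfderiv_subtypeVal]
  exact ContinuousLinearMap.comp_id _

/-- **The chart-straight curves of an open submanifold are those of the ambient manifold**, near
`t = 0`: the chart of `W` at `y` is the restriction of the chart of `N` at `↑y`, so
`ι ∘ curveThrough_W y v` and `curveThrough_N (ι y) v` agree for small `|t|` (they may differ for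
large `|t|`, where the inverse charts take junk values). [folklore] -/
theorem subtypeVal_comp_curveThrough_eventuallyEq (y : W) (v : TangentSpace I' y) :
    (Subtype.val ∘ curveThrough I' y v) =ᶠ[𝓝 0] curveThrough I' (y : N) v := by
  have h1 := TopologicalSpace.Opens.chartAt_subtype_val_symm_eventuallyEq (H := H') W (x := y)
  have hz : Tendsto (fun t : ℝ ↦ I'.symm (extChartAt I' (y : N) y + t • (show E' from v))) (𝓝 0)
      (𝓝 (chartAt H' (y : N) y)) := by
    have hc : Continuous fun t : ℝ ↦ I'.symm (extChartAt I' (y : N) y + t • (show E' from v)) :=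
      I'.continuous_symm.comp (continuous_const.add (continuous_id.smul continuous_const))
    have := hc.tendsto 0
    simp only [zero_smul, add_zero, extChartAt_coe, Function.comp_apply,
      ModelWithCorners.left_inv] at this
    exact this
  filter_upwards [hz.eventually h1] with t ht
  have hy : extChartAt I' y y = extChartAt I' (y : N) y := rfl
  simp only [Function.comp_apply, curveThrough, extChartAt_coe_symm, hy]
  simp only [Function.comp_apply, TopologicalSpace.Opens.chartAt_eq] at ht ⊢
  exact ht.symm

end SubtypeVal

/-! ### Locality of the covariant derivative along a curve -/

section CovariantDerivAlong

variable [IsManifold I ∞ M] [FiniteDimensional ℝ E]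
  (cov : CovariantDerivative I E (TangentSpace I : M → Type _))

/-- **Locality of the covariant derivative along a curve.** The canonical-frame formula
`DW/dt = ∑ᵢ (cⁱ)' sᵢ + ∑ᵢ cⁱ ∇_{γ'} sᵢ` defining `covariantDerivAlong` (O'Neill 1983, Ch. 3,
proof of Prop. 3.18) only involves the germ at `t₀` of the lift `t ↦ (γ t, W t) ∈ TM`: two vector
fields along two curves whose lifts agree near `t₀` have the same covariant derivative at `t₀`
(a cross-fibre equation, both sides living in `E = T_{γ' t₀} M = T_{γ t₀} M`). The special case
`W = γ'` is the tree's `covariantDerivAlong_velocity_congr` (`GeodesicProofs.lean`).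
[cite: ONeill1983, Ch. 3, Prop. 3.18] -/
theorem covariantDerivAlong_congr_of_eventuallyEq {γ γ' : ℝ → M}
    {W : Π t : ℝ, TangentSpace I (γ t)} {W' : Π t : ℝ, TangentSpace I (γ' t)} {t₀ : ℝ}
    (h : (fun t ↦ (TotalSpace.mk' E (γ' t) (W' t) : TangentBundle I M)) =ᶠ[𝓝 t₀]
      fun t ↦ (TotalSpace.mk' E (γ t) (W t) : TangentBundle I M)) :
    covariantDerivAlong cov γ' W' t₀ = covariantDerivAlong cov γ W t₀ := by
  have hγ : γ' =ᶠ[𝓝 t₀] γ := h.mono fun t ht ↦ congrArg TotalSpace.proj ht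
  have hv : velocity I γ' t₀ = velocity I γ t₀ := DFunLike.congr_fun hγ.mfderiv_eq (1 : ℝ)
  /- the canonical-frame formula as a function `Ψ L p u` of a lift `L : ℝ → TM` (entering only
  through the germs at `t₀` of the coefficient functions `t ↦ cⁱ(L t)`), a point `p ∈ TM` (base
  point of the frame, argument of everything else) and a velocity `u` -/
  let Ψ : (ℝ → TangentBundle I M) → TangentBundle I M → E → E := fun L p u ↦
    ∑ i, deriv (fun t ↦ (trivializationAt E (TangentSpace I : M → Type _) p.proj).localFrame_coeff
        I (Module.finBasis ℝ E) i (L t).proj (L t).snd) t₀ •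
        (trivializationAt E (TangentSpace I : M → Type _) p.proj).localFrame
          (Module.finBasis ℝ E) i p.proj
      + ∑ i, (trivializationAt E (TangentSpace I : M → Type _) p.proj).localFrame_coeff
        I (Module.finBasis ℝ E) i p.proj p.snd •
        cov ((trivializationAt E (TangentSpace I : M → Type _) p.proj).localFrame
          (Module.finBasis ℝ E) i) p.proj u
  have hΨ : ∀ (δ : ℝ → M) (V : Π t : ℝ, TangentSpace I (δ t)), covariantDerivAlong cov δ V t₀ =
      Ψ (fun t ↦ TotalSpace.mk' E (δ t) (V t)) (TotalSpace.mk' E (δ t₀) (V t₀))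
        (velocity I δ t₀) := fun _ _ ↦ rfl
  have hcongr : ∀ {L L' : ℝ → TangentBundle I M} (p : TangentBundle I M) (u : E),
      L' =ᶠ[𝓝 t₀] L → Ψ L' p u = Ψ L p u := by
    intro L L' p u hL
    simp only [Ψ]
    congr 1
    refine Finset.sum_congr rfl fun i _ ↦ ?_
    congr 1
    apply Filter.EventuallyEq.deriv_eq
    filter_upwards [hL] with t ht
    rw [ht]
  rw [hΨ γ' W', hΨ γ W, h.eq_of_nhds, hv]
  exact hcongr _ _ h

end CovariantDerivAlong

/-! ### Restriction of hypersurface data to an open subset -/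

namespace PseudoRiemannianMetric

section Trace

variable [FiniteDimensional ℝ E'] {n : ℕ∞ω}
  {N₁ : Type*} [TopologicalSpace N₁] [ChartedSpace H' N₁] [IsManifold I' ∞ N₁]
  {N₂ : Type*} [TopologicalSpace N₂] [ChartedSpace H' N₂] [IsManifold I' ∞ N₂]
  {g₁ : PseudoRiemannianMetric I' n E' (TangentSpace I' : N₁ → Type _)}
  {g₂ : PseudoRiemannianMetric I' n E' (TangentSpace I' : N₂ → Type _)} {b₁ : N₁} {b₂ : N₂}

/-- Index raising only depends on the scalar product on the fibre: two metrics (on the tangent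
bundles of two manifolds with the same model) which agree at two points, as bilinear forms on the
common model fibre `E'`, have the same `♯` there (characterisation `g(♯α, w) = α w` and
nondegeneracy). A cross-base equation, both sides living in `E'`. O'Neill 1983, Ch. 3, p. 60.
[cite: ONeill1983, Ch. 3, p. 60] -/
theorem sharp_congr_of_val_eq (h : (g₁.val b₁ : E' →L[ℝ] E' →L[ℝ] ℝ) = g₂.val b₂)
    (α : Module.Dual ℝ E') : (g₁.sharp b₁ α : E') = g₂.sharp b₂ α := by
  apply g₂.flat_injective b₂
  refine LinearMap.ext fun w ↦ ?_
  change g₂.val b₂ (g₁.sharp b₁ α) w = g₂.val b₂ (g₂.sharp b₂ α) w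
  have h₁ : (g₂.val b₂ : E' →L[ℝ] E' →L[ℝ] ℝ) (g₁.sharp b₁ α) w = α w :=
    (congrArg (fun X : E' →L[ℝ] E' →L[ℝ] ℝ ↦ X (g₁.sharp b₁ α) w) h).symm.trans
      (g₁.val_sharp_apply b₁ α w)
  exact h₁.trans (g₂.val_sharp_apply b₂ α w).symm

/-- The metric trace `tr_g T = g^{ij} T_{ij}` only depends on the scalar product on the fibre (see
`sharp_congr_of_val_eq`). O'Neill 1983, Ch. 3, pp. 60–61. [cite: ONeill1983, Ch. 3, pp. 60–61] -/
theorem trace_congr_of_val_eq (h : (g₁.val b₁ : E' →L[ℝ] E' →L[ℝ] ℝ) = g₂.val b₂)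
    (T : LinearMap.BilinForm ℝ E') : g₁.trace b₁ T = g₂.trace b₂ T := by
  -- both traces are `F B hB` for the scalar product `B` on the model fibre `E'`
  let F : (B : LinearMap.BilinForm ℝ E') → B.Nondegenerate → ℝ := fun B hB ↦
    LinearMap.trace ℝ E' ((B.toDual hB).symm.toLinearMap ∘ₗ T)
  have hF : ∀ (B₁ B₂ : LinearMap.BilinForm ℝ E') (p₁ : B₁.Nondegenerate) (p₂ : B₂.Nondegenerate),
      B₁ = B₂ → F B₁ p₁ = F B₂ p₂ := by
    rintro B₁ _ p₁ p₂ rfl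
    rfl
  have hB : (g₁.toBilinForm b₁ : LinearMap.BilinForm ℝ E') = g₂.toBilinForm b₂ :=
    congrArg (fun X : E' →L[ℝ] E' →L[ℝ] ℝ ↦ (X.toLinearMap₁₂ : LinearMap.BilinForm ℝ E')) h
  exact hF (g₁.toBilinForm b₁) (g₂.toBilinForm b₂) (g₁.nondegenerate_toBilinForm b₁)
    (g₂.nondegenerate_toBilinForm b₂) hB

end Trace

section Restrict

variable [IsManifold I ∞ M] {n : ℕ∞ω} {W : TopologicalSpace.Opens N}
  {g : PseudoRiemannianMetric I n E (TangentSpace I : M → Type _)}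

variable (g) in
/-- The induced form of the restriction `f|_W` at `y ∈ W` is that of `f` at `y` (`dι = id`).
O'Neill 1983, Ch. 4, p. 97. [cite: ONeill1983, Ch. 4, p. 97] -/
theorem inducedBilin_comp_subtypeVal {f : N → M} (y : W) (hf : MDifferentiableAt I' I f y.1) :
    (g.inducedBilin I' (f ∘ Subtype.val : W → M) y :
      E' →L[ℝ] E' →L[ℝ] ℝ) = g.inducedBilin I' f y.1 := by
  ext v w
  simp only [inducedBilin_apply, Function.comp_apply, mfderiv_comp_subtypeVal hf]
  rfl

/-- **A spacelike immersion restricts to a spacelike immersion** of any open subset.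
O'Neill 1983, Ch. 4, p. 97. [cite: ONeill1983, Ch. 4, p. 97] -/
theorem IsSpacelikeImmersion.comp_subtypeVal {f : N → M} (hf : g.IsSpacelikeImmersion I' f) :
    g.IsSpacelikeImmersion I' (f ∘ Subtype.val : W → M) := by
  refine ⟨hf.contMDiff.comp contMDiff_subtype_val, fun y v hv ↦ ?_⟩
  have hd : MDifferentiableAt I' I f y.1 :=
    (hf.contMDiff y.1).mdifferentiableAt (by simp)
  have := hf.inducedBilin_pos y.1 hv
  rwa [← inducedBilin_comp_subtypeVal g y hd] at this

/-- **A unit normal restricts to a unit normal** along the restriction to an open subset.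
O'Neill 1983, Ch. 4, pp. 106–107. [cite: ONeill1983, Ch. 4, pp. 106–107] -/
theorem IsUnitNormal.comp_subtypeVal {f : N → M} {ν : NormalField I f} {ε : ℝ}
    (h : g.IsUnitNormal I' f ν ε) (hf : ∀ y, MDifferentiableAt I' I f y) :
    g.IsUnitNormal I' (f ∘ Subtype.val : W → M) (fun y ↦ ν y.1) ε :=
  ⟨fun y v ↦ by rw [mfderiv_comp_subtypeVal (hf y.1)]; exact h.1 y.1 v, fun y ↦ h.2 y.1⟩

variable [FiniteDimensional ℝ E] [g.HasLeviCivita]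

variable (g) in
/-- **Locality of `D_v ν`**: the covariant derivative of the restricted normal field `ν|_W` along
`f|_W` in the direction `v ∈ T_y W = T_y N` is that of `ν` along `f` (the chart-straight curves
agree near `t = 0`, `subtypeVal_comp_curveThrough_eventuallyEq`, and `covariantDerivAlong` is
local, `covariantDerivAlong_congr_of_eventuallyEq`). O'Neill 1983, Ch. 4, pp. 98–99.
[cite: ONeill1983, Ch. 4, pp. 98–99] -/
theorem normalDerivAlong_comp_subtypeVal (f : N → M) (ν : NormalField I f) (y : W)
    (v : TangentSpace I' y) :
    g.normalDerivAlong (f ∘ Subtype.val : W → M) (fun y ↦ ν y.1) y v =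
      g.normalDerivAlong (I' := I') f ν y.1 v := by
  unfold normalDerivAlong
  apply covariantDerivAlong_congr_of_eventuallyEq
  filter_upwards [subtypeVal_comp_curveThrough_eventuallyEq y v] with t ht
  simp only [Function.comp_apply] at ht ⊢
  rw [ht]

variable [FiniteDimensional ℝ E']

variable (g) in
/-- **Locality of the second fundamental form**: `K_{ν|_W} = K_ν` at points of the open subset
`W` (from `normalDerivAlong_comp_subtypeVal` and `dι = id`). O'Neill 1983, Ch. 4, Lemma 4.4 ff.
[cite: ONeill1983, Ch. 4, Lemma 4.4 ff.] -/
theorem secondFundamentalForm_comp_subtypeVal (f : N → M) (ν : NormalField I f) (y : W)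
    (hf : MDifferentiableAt I' I f y.1) :
    g.secondFundamentalForm I' (f ∘ Subtype.val : W → M) (fun y ↦ ν y.1) y =
      g.secondFundamentalForm I' f ν y.1 := by
  haveI : FiniteDimensional ℝ (TangentSpace I' y) := inferInstanceAs (FiniteDimensional ℝ E')
  refine (Module.finBasis ℝ (TangentSpace I' y)).ext fun i ↦ LinearMap.ext fun w ↦ ?_
  have h1 := g.secondFundamentalForm_apply_basis (I' := I') (f ∘ Subtype.val : W → M)
    (fun y ↦ ν y.1) y i w
  have h2 := g.secondFundamentalForm_apply_basis (I' := I') f ν y.1 i w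
  rw [normalDerivAlong_comp_subtypeVal, mfderiv_comp_subtypeVal hf] at h1
  exact h1.trans h2.symm

variable [IsManifold I' ∞ N]

/-- **Locality of the mean curvature**: `H_{f|_W} = H_f` on the open subset `W` (the induced
metric, `inducedBilin_comp_subtypeVal`, and the second fundamental form,
`secondFundamentalForm_comp_subtypeVal`, agree pointwise, and the metric trace only depends on
these, `trace_congr_of_val_eq`). Wald 1984, (10.2.13) ff. [cite: Wald1984, (10.2.13)] -/
theorem meanCurvature_comp_subtypeVal {f : N → M} (hpb : contMDiff_pullbackBilin I M I' N n)
    (hpbW : contMDiff_pullbackBilin I M I' W n) (hf : g.IsSpacelikeImmersion I' f)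
    (ν : NormalField I f) (y : W) :
    g.meanCurvature (f ∘ Subtype.val : W → M) hpbW hf.comp_subtypeVal (fun y ↦ ν y.1) y =
      g.meanCurvature f hpb hf ν y.1 := by
  have hd : MDifferentiableAt I' I f y.1 := (hf.contMDiff y.1).mdifferentiableAt (by simp)
  unfold meanCurvature
  rw [secondFundamentalForm_comp_subtypeVal g f ν y hd]
  exact trace_congr_of_val_eq (by simp [inducedBilin_comp_subtypeVal g y hd]) _

/-- **A minimal (maximal) immersion restricts to a minimal immersion** of any open subset:
`H = 0` is a pointwise, local condition. Choquet-Bruhat 2009, Ch. VI §3.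
[cite: ChoquetBruhat2009, Ch. VI §3] -/
theorem IsMaximalSlice.comp_subtypeVal {f : N → M} {hpb : contMDiff_pullbackBilin I M I' N n}
    {hf : g.IsSpacelikeImmersion I' f} {ν : NormalField I f} (h : g.IsMaximalSlice f hpb hf ν)
    (hpbW : contMDiff_pullbackBilin I M I' W n) :
    g.IsMaximalSlice (f ∘ Subtype.val : W → M) hpbW hf.comp_subtypeVal (fun y ↦ ν y.1) :=
  fun y ↦ by rw [meanCurvature_comp_subtypeVal hpb hpbW hf ν y]; exact h y.1

end Restrict

end PseudoRiemannianMetric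

/-! ### Smoothness of the restricted normal; the restriction of an embedding -/

section Embedding

variable [IsManifold I ∞ M] {W : TopologicalSpace.Opens N}

/-- The restriction of a smooth normal field (smooth as a map into `TM`) to an open subset is
smooth. [folklore] -/
theorem contMDiff_normal_comp_subtypeVal {f : N → M} {ν : NormalField I f}
    (hν : ContMDiff I' I.tangent ∞
      (fun y ↦ (TotalSpace.mk' E (f y) (ν y) : TangentBundle I M))) :
    ContMDiff I' I.tangent ∞
      (fun y : W ↦ (TotalSpace.mk' E (f y.1) (ν y.1) : TangentBundle I M)) :=
  hν.comp contMDiff_subtype_val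

variable [IsManifold I' ∞ N]

omit [IsManifold I ∞ M] in
/-- **The restriction of a smooth embedding to an open subset is a smooth embedding** (the
inclusion `W ↪ N` is a globally defined partial diffeomorphism; the tree's
`Manifold.IsSmoothEmbedding.comp_openPartialHomeomorph`). Lee 2013, Ch. 5. [folklore] -/
theorem isSmoothEmbedding_comp_subtypeVal {f : N → M} (hf : Manifold.IsSmoothEmbedding I' I ∞ f) :
    Manifold.IsSmoothEmbedding I' I ∞ (f ∘ Subtype.val : W → M) := by
  rcases isEmpty_or_nonempty W with hW | hW
  · exact ⟨Manifold.IsImmersionOfComplement.isImmersion (F := Unit) fun x ↦ isEmptyElim x,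
      hf.isEmbedding.comp Topology.IsEmbedding.subtypeVal⟩
  have hemb : Topology.IsOpenEmbedding (Subtype.val : W → N) := W.2.isOpenEmbedding_subtypeVal
  set Φ := hemb.toOpenPartialHomeomorph (Subtype.val : W → N) with hΦ
  have hΦι : ⇑Φ = Subtype.val := hemb.toOpenPartialHomeomorph_apply _
  have hsrc : Φ.source = univ := hemb.toOpenPartialHomeomorph_source _
  have htgt : Φ.target = range (Subtype.val : W → N) := hemb.toOpenPartialHomeomorph_target _
  have hΦsm : ContMDiffOn I' I' ∞ Φ Φ.source := by
    rw [hΦι]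
    exact contMDiff_subtype_val.contMDiffOn
  have hΦ'sm : ContMDiffOn I' I' ∞ Φ.symm Φ.target := by
    have key : ∀ z ∈ Φ.target, ((Φ.symm z : W) : N) = z := by
      intro z hz
      rw [htgt] at hz
      obtain ⟨x, rfl⟩ := hz
      rw [← hΦι, Φ.left_inv (hsrc ▸ mem_univ x)]
    intro z hz
    refine (ContMDiffWithinAt.subtypeVal_comp_iff W Φ.symm Φ.target z).1 ?_
    exact (contMDiff_id.contMDiffAt.contMDiffWithinAt (s := Φ.target)).congr
      (fun z' hz' ↦ key z' hz') (key z hz)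
  have := hf.comp_openPartialHomeomorph Φ hsrc hΦsm hΦ'sm
  rwa [hΦι] at this

end Embedding

end Literature.Geometry.Lorentzian

end
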